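import Summits.CriticalPhenomena.CardyFormulaZ2.Theorems.CardyMagicRigidityNestingRigidityNeckZ2VirtualEdges
import Literature.Probability.Percolation.QuadCrossingDiscreteGluingGarban
import Literature.Probability.Percolation.HalfSpaceBrickSeeds
import HarnessLib

/-!
# Crux `NestingRigidity`, line `pinch-resampling` (v4), stub S12: node events over disjoint annuli multiply, and each costs `(r/R)^{1+ε}`

Crux `Summit.CriticalPhenomena.CardyFormulaZ2.Theses.CardyMagicRigidity.NestingRigidity`
(stmt-CriticalPhenomena-4835), line `pinch-resampling` v4, stub S12 `stub_neckHookupCoarseZ2 : NeckHookupCoarseZ2`.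
The probabilistic primitive consumed by the multi-scale summation of the node events of `…NeckZ2ErrorCover`
(S11 road map, item 2: "product over hierarchy nodes by independence of events determined by disjoint annuli"),
entirely from tree theorems:

* `NeckCoarseZ2.determinedBy_fourArmTwoClustersAt`, `…measurableSet_fourArmTwoClustersAt`: the cluster-form four-arm
  event `fourArmTwoClustersAt w r R` (`FourArmGarbanShift.lean`) reads only the pairs of its annulus `zAnn w r R`;
* `NeckCoarseZ2.real_biInter_fourArmTwoClustersAt_eq_prod`: four-arm events around pairwise DISJOINT annuli are
  jointly independent under `P_{1/2}` (`bondPercolation_real_biInter_eq_prod`);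
* `real_biInter_fourArmTwoClustersAt_le_prod_rpow` (registered anchor): hence their joint probability is at most
  `∏ c (r_i / R_i)^{1+ε}` with the constants `c, ε > 0` of the tree's unconditional multi-scale four-arm bound for
  critical bond percolation on `ℤ²` (`QuadCrossing.fourArm_bound`, Garban's Appendix B of Schramm–Smirnov 2011 as
  proved in `FourArmGarbanHolds.lean`, moved to the centre `w` by `real_fourArmTwoClustersAt`).
-/

noncomputable section

namespace Summit.CriticalPhenomena.CardyFormulaZ2.Cruxes.NestingRigidity.PinchResampling

open MeasureTheory Set Literature.Probability.Percolation Literature.Probability.LatticeModels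
open ZPinchLocality

namespace NeckCoarseZ2

/-- The cluster-form four-arm event around `w` reads only the pairs of its annulus. -/
theorem determinedBy_fourArmTwoClustersAt (w : Site 2) {r : ℕ} (hr : 1 ≤ r) (R : ℕ) :
    DeterminedBy (fourArmTwoClustersAt w r R) (zAnn w r R).sym2 := by
  have hc : ∀ a b, DeterminedBy (openConnIn ((· + w) '' sqAnnulus r R) a b) (zAnn w r R).sym2 := fun a b ↦
    DCT16.determinedBy_openConnIn _ a b (by rw [image_add_sqAnnulus_eq_zAnn hr])
  rw [determinedBy_iff]
  intro ω ω' h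
  have hc' : ∀ a b, ω ∈ openConnIn ((· + w) '' sqAnnulus r R) a b ↔ ω' ∈ openConnIn ((· + w) '' sqAnnulus r R) a b :=
    fun a b ↦ (determinedBy_iff _ _).1 (hc a b) ω ω' h
  simp only [fourArmTwoClustersAt, mem_setOf_eq, hc']

/-- The annulus is finite. -/
theorem zAnn_finite (w : Site 2) (r R : ℕ) : (zAnn w r R).Finite :=
  (zBall_finite w R).subset fun _ hy ↦ hy.2

/-- The cluster-form four-arm event around `w` is measurable. -/
theorem measurableSet_fourArmTwoClustersAt (w : Site 2) {r : ℕ} (hr : 1 ≤ r) (R : ℕ) :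
    MeasurableSet (fourArmTwoClustersAt w r R) := by
  have h := determinedBy_fourArmTwoClustersAt w hr R
  rw [← (finite_sym2 (zAnn_finite w r R)).coe_toFinset] at h
  exact h.measurableSet_of_finset

/-- Disjoint annuli have disjoint pair sets. -/
theorem disjoint_sym2_of_disjoint {A B : Set (Site 2)} (h : Disjoint A B) : Disjoint A.sym2 B.sym2 :=
  Set.disjoint_left.2 fun e he he' ↦
    Set.disjoint_left.1 h (Set.mem_sym2_iff_subset.1 he (Sym2.out_fst_mem e))
      (Set.mem_sym2_iff_subset.1 he' (Sym2.out_fst_mem e))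

/-- **Four-arm events around pairwise disjoint annuli are jointly independent under `P_{1/2}`.** -/
theorem real_biInter_fourArmTwoClustersAt_eq_prod {ι : Type*} (t : Finset ι) (w : ι → Site 2) (r R : ι → ℕ)
    (hr : ∀ i ∈ t, 1 ≤ r i) (hdisj : (↑t : Set ι).PairwiseDisjoint fun i ↦ zAnn (w i) (r i) (R i)) :
    (bondPercolation (zdGraph 2) half).real (⋂ i ∈ t, fourArmTwoClustersAt (w i) (r i) (R i)) =
      ∏ i ∈ t, (bondPercolation (zdGraph 2) half).real (fourArmTwoClustersAt (w i) (r i) (R i)) :=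
  bondPercolation_real_biInter_eq_prod (zdGraph 2) half t _ (fun i ↦ (zAnn (w i) (r i) (R i)).sym2)
    (fun i hi ↦ determinedBy_fourArmTwoClustersAt (w i) (hr i hi) (R i))
    (fun i hi ↦ measurableSet_fourArmTwoClustersAt (w i) (hr i hi) (R i))
    fun _ hi _ hj hij ↦ disjoint_sym2_of_disjoint (hdisj hi hj hij)

end NeckCoarseZ2

/-- **Node events over disjoint annuli cost the product of the two-radius four-arm bounds (registered helper,
anchor of this module on the crux item).**  There are `c, ε > 0` (the constants of `QuadCrossing.fourArm_bound`)
such that for every finite family of pairwise disjoint square annuli `zAnn (w i) (r i) (R i)` with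
`1 ≤ r i ≤ R i`, the probability under `P_{1/2}` on `ℤ²` that every annulus carries the cluster-form four-arm event
is at most `∏ c (r i / R i)^{1+ε}`. -/
theorem real_biInter_fourArmTwoClustersAt_le_prod_rpow : ∃ c ε : ℝ, 0 < c ∧ 0 < ε ∧ ∀ (ι : Type) (t : Finset ι) (w : ι → Site 2) (r R : ι → ℕ), (∀ i ∈ t, 1 ≤ r i ∧ r i ≤ R i) → (↑t : Set ι).PairwiseDisjoint (fun i ↦ NeckCoarseZ2.zAnn (w i) (r i) (R i)) → (bondPercolation (zdGraph 2) half).real (⋂ i ∈ t, fourArmTwoClustersAt (w i) (r i) (R i)) ≤ ∏ i ∈ t, c * ((r i : ℝ) / R i) ^ (1 + ε) := by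
  obtain ⟨c, ε, hc, hε, h4⟩ := QuadCrossing.fourArm_bound
  refine ⟨c, ε, hc, hε, fun ι t w r R hrR hdisj ↦ ?_⟩
  rw [NeckCoarseZ2.real_biInter_fourArmTwoClustersAt_eq_prod t w r R (fun i hi ↦ (hrR i hi).1) hdisj]
  refine Finset.prod_le_prod (fun i _ ↦ measureReal_nonneg) fun i hi ↦ ?_
  rw [real_fourArmTwoClustersAt]
  exact h4 (r i) (R i) (hrR i hi).1 (hrR i hi).2

end Summit.CriticalPhenomena.CardyFormulaZ2.Cruxes.NestingRigidity.PinchResampling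

end
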